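import Literature.Analysis.FluidPDE.TaoCascadeRescaledExit
import Mathlib.MeasureTheory.Integral.IntervalIntegral.ContDiff
import HarnessLib

/-!
# Tao's cascade ODE, §6.6: the second bootstrap time `T₂` and Cor. 6.14

T. Tao, *Finite time blowup for an averaged three-dimensional Navier–Stokes equation*,
J. Amer. Math. Soc. 29 (2016), 601–674 = arXiv:1402.0290v3, §6.6 (equation numbers of arXiv v3):
"Let `T₂` be the largest time in `[0, T₁]` such that `∫₀^{T₂} a₁(t)² dt ≤ K^{-1/4}`. Combining
Proposition 6.13 with Corollary 6.11 and using continuity, we conclude **Corollary 6.14** (exit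
trichotomy, again): (6.126) `Ẽ₋₁(T₂) = K⁻¹⁰(1+ε₀)^{2/10}`, or (6.127) `∫₀^{T₂} a₁² = K^{-1/4}`, or
(6.128) `T₂ = 100`."

This file proves Cor. 6.14 on top of the §6.5 files (`TaoCascadeRescaledBootstrap.lean`,
`TaoCascadeRescaledExit.lean`: `GoodAt`, `T1`, Cor. 6.11 `exit_trichotomy`):

* `RescaledHypotheses.exists_second_bootstrap_time` — **Cor. 6.14**: from a time
  `T₁ ∈ [0, 100]` at which the trichotomy of Cor. 6.11 holds, and the forwards-exit exclusion
  supplied by Prop. 6.13 ((6.119): `|d₁(T)| < ½K⁻¹⁰` at every `T ≤ T₁` with `∫₀ᵀ a₁² ≤ K^{-1/4}` —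
  taken as a hypothesis, in exactly this weak form), there is `T₂ ∈ [0, T₁]`
  (namely `maximalTimeP (∫₀ᵗ a₁² ≤ K^{-1/4}) 0 T₁`) with `∫₀ᵗ a₁² ≤ K^{-1/4}` on `[0, T₂]` and
  (6.126) ∨ (6.127) ∨ (6.128) at `T₂` (stated as the literal disjunction; it is definitionally the
  predicate `ZeroScale.ExitTrichotomy … T₂` of `TaoCascadeZeroScaleSetup.lean`); the proof is the
  quoted one (continuity of the primitive, the exit principle of `maximalTimeP`, Cor. 6.11 when
  `T₂ = T₁`);
* `RescaledHypotheses.exists_second_bootstrap_time_T1` — the same for the maximal time `T1` of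
  §6.5 under the largeness hypotheses of `exit_trichotomy`, with `GoodAt` on `[0, T₂]`.

Theorems only (no new definitions).

## References

* T. Tao, J. Amer. Math. Soc. 29 (2016), 601–674 = arXiv:1402.0290v3, §6.6: the definition of `T₂`
  and Cor. 6.14 (6.126)–(6.128). [`Tao2016AveragedNS`]
-/

noncomputable section

open Set MeasureTheory intervalIntegral Filter
open scoped _root_.Topology

namespace Literature.Analysis.FluidPDE

namespace TaoCascade

open Literature.Analysis.ODE

section SecondBootstrap

variable {γ ε₀ K ε C₁ C₂ C₃ : ℝ} {n₀ N : ℤ} {τ : ℤ → ℝ} {Xr : Fin 4 → ℤ → ℝ → ℝ} {Er : ℤ → ℝ → ℝ}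

/-- The primitive `t ↦ ∫₀ᵗ a₁²` is continuous on `[0, T]` ("using continuity").
[cite: Tao2016AveragedNS, §6.6, definition of T₂] -/
theorem RescaledHypotheses.continuousOn_integral_a_one_sq
    (h : RescaledHypotheses γ ε₀ K ε C₁ C₂ C₃ n₀ N τ Xr Er) (hN : n₀ ≤ N) {T : ℝ} (hT : 0 ≤ T) :
    ContinuousOn (fun t => ∫ s in (0 : ℝ)..t, Xr 0 1 s ^ 2) (Icc 0 T) := by
  have hcont : ContinuousOn (fun s => Xr 0 1 s ^ 2) (Icc 0 T) :=
    (h.continuousOn_X 0 1 (h.tau_init_le hN)).pow 2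
  have hint : IntegrableOn (fun s => Xr 0 1 s ^ 2) (uIcc 0 T) volume := by
    rw [uIcc_of_le hT]
    exact hcont.integrableOn_Icc
  have := intervalIntegral.continuousOn_primitive_interval (μ := volume) hint
  rwa [uIcc_of_le hT] at this

/-- **Cor. 6.14 (exit trichotomy, again), proved**: let `T₁ ∈ [0, 100]` be a time at which the
trichotomy of Cor. 6.11 holds, and assume the forwards-exit exclusion of Prop. 6.13, (6.119), in the
form "`|d₁(T)| < ½ K⁻¹⁰` whenever `0 ≤ T ≤ T₁` and `∫₀ᵀ a₁² ≤ K^{-1/4}`". Then the largest time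
`T₂ ∈ [0, T₁]` with `∫₀^{T₂} a₁² ≤ K^{-1/4}` satisfies (6.126) ∨ (6.127) ∨ (6.128), and
`∫₀ᵗ a₁² ≤ K^{-1/4}` for all `t ∈ [0, T₂]`.
[cite: Tao2016AveragedNS, §6.6 Cor. 6.14] -/
theorem RescaledHypotheses.exists_second_bootstrap_time
    (h : RescaledHypotheses γ ε₀ K ε C₁ C₂ C₃ n₀ N τ Xr Er) (hN : n₀ ≤ N) (hK : 0 < K) {T₁ : ℝ}
    (hT₁ : T₁ ∈ Icc (0 : ℝ) 100)
    (hexit : Er (-1) T₁ = (K ^ 10)⁻¹ * (1 + ε₀) ^ ((2 : ℝ) / 10) ∨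
      |Xr 3 1 T₁| = 1 / 2 * (K ^ 10)⁻¹ ∨ T₁ = 100)
    (h13d : ∀ T ∈ Icc 0 T₁, (∫ t in (0 : ℝ)..T, Xr 0 1 t ^ 2) ≤ K ^ (-(1 : ℝ) / 4) →
      |Xr 3 1 T| < 1 / 2 * (K ^ 10)⁻¹) :
    ∃ T₂ ∈ Icc 0 T₁, (∀ t ∈ Icc 0 T₂, (∫ s in (0 : ℝ)..t, Xr 0 1 s ^ 2) ≤ K ^ (-(1 : ℝ) / 4)) ∧
      (Er (-1) T₂ = (K ^ 10)⁻¹ * (1 + ε₀) ^ ((2 : ℝ) / 10) ∨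
        (∫ t in (0 : ℝ)..T₂, Xr 0 1 t ^ 2) = K ^ (-(1 : ℝ) / 4) ∨ T₂ = 100) := by
  set P : ℝ → Prop := fun t => (∫ s in (0 : ℝ)..t, Xr 0 1 s ^ 2) ≤ K ^ (-(1 : ℝ) / 4) with hP
  set I : ℝ → ℝ := fun t => ∫ s in (0 : ℝ)..t, Xr 0 1 s ^ 2 with hI
  have h0T : (0 : ℝ) ≤ T₁ := hT₁.1
  have hP0 : P 0 := by
    show (∫ s in (0 : ℝ)..0, Xr 0 1 s ^ 2) ≤ K ^ (-(1 : ℝ) / 4)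
    rw [intervalIntegral.integral_same]
    positivity
  have hIc : ContinuousOn I (Icc 0 T₁) := h.continuousOn_integral_a_one_sq hN h0T
  have hclosed : ∀ t ∈ Ioc (0 : ℝ) T₁, (∀ s ∈ Ico 0 t, P s) → P t := fun t ht hs =>
    le_of_Ico_of_continuousOn (F := I) ht.1 (hIc.mono (Icc_subset_Icc le_rfl ht.2)) hs
  set T₂ : ℝ := maximalTimeP P 0 T₁ with hT₂
  have hmem : T₂ ∈ Icc 0 T₁ := maximalTimeP_mem h0T hP0
  have hspec : ∀ t ∈ Icc 0 T₂, P t := fun t ht => maximalTimeP_spec h0T hP0 hclosed ht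
  refine ⟨T₂, hmem, hspec, ?_⟩
  rcases maximalTimeP_exit h0T hP0 with heq | hnot
  · -- `T₂ = T₁`: Cor. 6.11 at `T₁`, the forwards exit (6.102) being excluded by Prop. 6.13
    have heq' : T₂ = T₁ := heq
    rcases hexit with h1 | h2 | h3
    · left; rw [heq']; exact h1
    · exfalso
      have hd := h13d T₁ ⟨h0T, le_rfl⟩ (heq' ▸ hspec T₂ ⟨hmem.1, le_rfl⟩)
      rw [h2] at hd
      exact lt_irrefl _ hd
    · right; right; rw [heq']; exact h3
  · -- `T₂ < T₁` (exit principle): `∫₀^{T₂} a₁² = K^{-1/4}` by continuity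
    right; left
    by_contra hne
    have hlt : I T₂ < K ^ (-(1 : ℝ) / 4) := lt_of_le_of_ne (hspec T₂ ⟨hmem.1, le_rfl⟩) hne
    have hcw : ContinuousWithinAt I (Icc 0 T₁) T₂ := hIc.continuousWithinAt hmem
    exact hnot ((hcw.eventually_lt_const hlt).mono fun t ht => ht.le)

/-- **Cor. 6.14 for the maximal time `T₁` of §6.5**, under the largeness hypotheses of Cor. 6.11
(`exit_trichotomy`) and the forwards-exit exclusion of Prop. 6.13 below `T₁`: there is
`T₂ ∈ [0, T₁]` with `∫₀ᵗ a₁² ≤ K^{-1/4}` on `[0, T₂]`, `GoodAt` on `[0, T₂]`, and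
(6.126) ∨ (6.127) ∨ (6.128) at `T₂`. [cite: Tao2016AveragedNS, §6.6 Cor. 6.14] -/
theorem RescaledHypotheses.exists_second_bootstrap_time_T1
    (h : RescaledHypotheses γ ε₀ K ε C₁ C₂ C₃ n₀ N τ Xr Er) (hε₀ : 0 < ε₀) (hε₀1 : ε₀ < 1)
    (hγ1 : γ ≤ 1 / 10 ^ 5) (hK : 0 < K) (hKε : 10 ^ 8 ≤ ε₀ * K ^ 4) (hε : 0 < ε) (hε1 : ε ≤ 1)
    (hC₂ : 0 ≤ C₂) (hC₃ : 0 ≤ C₃) (hN : n₀ ≤ N)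
    (hn : C₂ * (1 + ε₀) ^ (-(n₀ : ℝ) / 2) * cumEnergyConst ε₀ C₃ ≤ 1 / 100)
    (h13d : ∀ T ∈ Icc 0 (T1 ε₀ K Xr Er), (∫ t in (0 : ℝ)..T, Xr 0 1 t ^ 2) ≤ K ^ (-(1 : ℝ) / 4) →
      |Xr 3 1 T| < 1 / 2 * (K ^ 10)⁻¹) :
    ∃ T₂ ∈ Icc 0 (T1 ε₀ K Xr Er),
      (∀ t ∈ Icc 0 T₂, (∫ s in (0 : ℝ)..t, Xr 0 1 s ^ 2) ≤ K ^ (-(1 : ℝ) / 4)) ∧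
        (∀ t ∈ Icc 0 T₂, GoodAt ε₀ K Xr Er t) ∧
          (Er (-1) T₂ = (K ^ 10)⁻¹ * (1 + ε₀) ^ ((2 : ℝ) / 10) ∨
            (∫ t in (0 : ℝ)..T₂, Xr 0 1 t ^ 2) = K ^ (-(1 : ℝ) / 4) ∨ T₂ = 100) := by
  have hK2 : (2 : ℝ) ≤ K := by linarith [hundred_le_of_regime hε₀1 hK hKε]
  have g0 := h.goodAt_zero hε₀ hε₀1 hγ1 hK2 hε hε1 hC₂ hC₃ hN hn
  have hT := T1_mem g0
  have hexit := h.exit_trichotomy hε₀ hε₀1 hγ1 hK hKε hε hε1 hC₂ hC₃ hN hn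
  obtain ⟨T₂, hmem, hint, hex⟩ := h.exists_second_bootstrap_time hN hK hT hexit h13d
  exact ⟨T₂, hmem, hint, fun t ht => h.goodAt_of_mem_T1 hN g0 ⟨ht.1, ht.2.trans hmem.2⟩, hex⟩

end SecondBootstrap

end TaoCascade

end Literature.Analysis.FluidPDE
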